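import Literature.IUT.HodgeArakelov.BadPrimeGaussianMonoidsGenuineRecordRestrictionIsoFamily
import Literature.IUT.HodgeArakelov.CohomologyLimitKummerEvaluation

/-!
# [IUTchII] Cor 3.5 (ii) "⥲" at the genuine `θ_env` data over `ℚ̄_pˣ` from PRINT-SHAPED inputs: the theta evaluation (E)
# replaced by «`θ` is the Kummer class of a function `f`» + «the VALUES `ev_t f = q_t`» along equivariant evaluations

S. Mochizuki, *Inter-universal Teichmüller theory II*, kurims Dec-2020 manuscript, Cor 3.5 (ii) p. 95, Cor 2.8 (i) p. 82 (the
restricted classes `θ^t` are the Kummer classes of the theta values), Rmk 2.5.1 (i) p. 72 (the theta value `q_v^{j²}`); S. Mochizuki, *The étale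
theta function …*, Prop 1.3 / Def 1.9 (the étale theta class is the Kummer class of the theta function), Prop 1.4 (iii) (its
values at the torsion points) [cite: Mochizuki2012, Cor 3.5 (ii) p.95]. Claim key DISPUTED (D-0012). PROOF-ONLY companion
(abc-iut cell, layer L6, seat abc-iut-w4-d004 gen 3; node **IUTchII:Cor3.5(ii)**, restriction-ISO clause; sub-DAG row
Cor-35.ii.r12). NO definition, NO `Prop` fact, NO instance.

ASSEMBLY of this seat's `exists_unique_restrictionIso'_toRecord_padic` (any inversion family; (K)(R)`hq₀` derived) with the
evaluation naturality `restriction_kummer_eq_kummer_eval` (`CohomologyLimitKummerEvaluation.lean`): the input (E)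
`hRθ : R_t θ = κ₀ (q_t)` is DERIVED from
* a `Π^tp_{X̲̲}`-module `Afun` "of functions" with compatible roots and coefficient datum `cf` (the Kummer map `κ_fun` of
  abc-iut-w4-d007 over `Π^tp_{Ÿ̲̲}`), and a PRESENTATION of the theta class `θ = κ_fun(f)` for one function `f`
  ([EtTh]: `η̲̈^Θ` is the Kummer class of the `l`-th root of the theta function on `Ÿ̲̲`);
* for every label `t`, an EVALUATION `ev_t : Afun →* ℚ̄_pˣ` equivariant along the section `s_t` (`ev_t (s_t g • a) = g • ev_t a`
  — evaluation at the `t`-labelled point, whose decomposition group is `s_t(G_v)`; abc-iut-L2 `NonCuspidalPoint.evalAt`) with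
  `c₀ ∘ Λ(ev_t) = cf`;
* the VALUES `ev_t f = q_t ∈ O` with `q_{t₀}` a non-unit ([EtTh] Prop 1.4 (iii): `q^{t²}` up to a unit; Rmk 2.5.1 (i)).
Result: **`exists_unique_restrictionIso'_toRecord_padic_of_evaluation`**. After it, the inputs of the Cor 3.5 (ii) restriction
isomorphism at the genuine data are ALL print-shaped data/identities of [EtTh] §1 (no junction hypothesis of [IUTchII] §3 remains):
sections + evaluations + the theta function with its Kummer presentation and its values + `horb` + the model data.
Nothing here asserts a disputed claim or takes a side on [IUTchIII] Cor 3.12; typed ≠ proved ≠ endorsed.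
-/

noncomputable section

namespace Literature.IUT.HodgeArakelov

namespace EtaleLevels

open Literature.AnabelianGeometry.EtaleTheta CohomologySystemOfContH1 EtaleThetaDataOfSetting TemperedThetaMonoids
  BadPrimeGaussianMonoids

variable {p : ℕ} [Fact p.Prime] {D : Literature.AnabelianGeometry.EtaleTheta.ThetaSetting p}
  {E : D.EtaleThetaData} {l : ℕ} (C : E.DoubleUnderline l) (hC : D.Compat) (hS : D.Sec2Hyps)
  (hl : l.Prime) (hp2 : p ≠ 2) (hpl : p ≠ l) (hζ : ∃ ζ : D.K, IsPrimitiveRoot ζ (4 * l))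
  (mods : ∀ M : ℕ+, D.CyclotomeMod l M)
  (f : contCocycles D.toTheta D.DeltaTheta C.GtpYdduu) (hf : f ∈ C.rootCocycles hC)
  (hmods : ∀ (M M' : ℕ+) (h : (M : ℕ) ∣ (M' : ℕ)) (x : D.lDeltaTheta l),
    MuN.red p M M' h ((mods M').red x) = (mods M).red x)
  (h15 : Literature.AnabelianGeometry.EtaleTheta.ThetaSetting.Prop15iii E hC) (L : C.CuspLabels)
  (hZ : ∀ M : ℕ+, Nonempty (ModelCyclotomes.lDeltaQuot (C.rigidData (mods M) hC hS h15 L) ≃*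
    Literature.IUT.HodgeTheaters.ZHat))
  (hcharY : EtaleThetaDataOfSetting.PiYddCharacteristic C)
  (hlim : Function.Bijective (rigidLimHom C hC hS hl hp2 hpl hζ mods f hf hmods h15 L hZ))
  [(EtaleThetaDataOfSetting.PiYdd C).Normal]
  {Iota : Type}
  (iota : Iota → ((thetaEnvData C hC hS hl hp2 hpl hζ mods f hf hmods h15 L hZ hcharY hlim).D.coh.lim ≃+
    (thetaEnvData C hC hS hl hp2 hpl hζ mods f hf hmods h15 L hZ hcharY hlim).D.coh.lim))
  {Lbl : Type*} {P₀ : TopGroup.{0}} (φ₀ : P₀ →* D.GtpTheta) (s : Lbl → (P₀ →* Pi C))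
  (hι : ∀ t, Continuous ((MonoidHom.id (Pi C)).comp (s t)))
  (hN : ∀ t, (⊤ : Subgroup P₀).map ((MonoidHom.id (Pi C)).comp (s t)) ≤ PiYdd C)
  (hφ : ∀ t, (phi C).comp ((MonoidHom.id (Pi C)).comp (s t)) = φ₀)
  [TopologicalSpace (PadicAlgCl p)ˣ]
  (c : CyclotomeCoefficients (phi C) (D.lDeltaTheta l) (PadicAlgCl p)ˣ)
  (hA : ∀ b : (PadicAlgCl p)ˣ, IsOpen (MulAction.stabilizer (Pi C) b : Set (Pi C)))
  (hfi : ∀ b : (PadicAlgCl p)ˣ, (MulAction.stabilizer (Pi C) b).FiniteIndex)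
  (O : Submonoid (PadicAlgCl p)ˣ)
  [MulDistribMulAction P₀ (PadicAlgCl p)ˣ]
  (c₀ : CyclotomeCoefficients φ₀ (D.lDeltaTheta l) (PadicAlgCl p)ˣ)
  (hA₀ : ∀ b : (PadicAlgCl p)ˣ, IsOpen (MulAction.stabilizer P₀ b : Set P₀))
  (hfi₀ : ∀ b : (PadicAlgCl p)ˣ, (MulAction.stabilizer P₀ b).FiniteIndex)
  -- the module of FUNCTIONS with its Kummer data over `Π^tp_{Ÿ̲̲}`
  {Afun : Type} [CommGroup Afun] [MulDistribMulAction (Pi C) Afun] [TopologicalSpace Afun] [RootableBy Afun ℕ]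
  (cf : CyclotomeCoefficients (phi C) (D.lDeltaTheta l) Afun)
  (hAf : ∀ a : Afun, IsOpen (MulAction.stabilizer (Pi C) a : Set (Pi C)))
  (hfif : ∀ a : Afun, (MulAction.stabilizer (Pi C) a).FiniteIndex)

/-- **(E) from print-shaped inputs**: if `θ` is the Kummer class of a function `fΘ ∈ Afun` (`hθf`), `ev_t : Afun →* ℚ̄_pˣ` are
evaluations equivariant along the sections (`hev`) compatible with the coefficient data (`hcev`), and the VALUES are
`ev_t fΘ = q_t ∈ O` (`hval`), then `R_t θ = κ₀ (q_t)` — the hypothesis `hRθ` of the Cor 3.5 (ii) iso clause at the record.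
[cite: Mochizuki2012, Cor 2.8 (i) p.82] -/
theorem hRθ_toRecord_of_evaluation
    (R : Lbl → (((thetaEnvData C hC hS hl hp2 hpl hζ mods f hf hmods h15 L hZ hcharY hlim).toRecord
        (h1LimConjMulAut (phi C) (D.lDeltaTheta l) (PiYdd C))
        (h1LimKummerOn (phi C) (D.lDeltaTheta l) (PiYdd C) c hA hfi O) iota).H →*
      Multiplicative (h1Lim φ₀ (D.lDeltaTheta l) (⊤ : Subgroup P₀) ⊥)))
    (hR : ∀ t y, Multiplicative.toAdd (R t y) =
      h1LimCongr (D.lDeltaTheta l) ⊤ (hφ t) ⊥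
        (h1LimComap (phi C) (D.lDeltaTheta l) ((MonoidHom.id (Pi C)).comp (s t)) (hι t) (hN t)
          (AddEquiv.additiveMultiplicative (h1Lim (phi C) (D.lDeltaTheta l) (PiYdd C) ⊥) (Additive.ofMul y))))
    (ev : Lbl → (Afun →* (PadicAlgCl p)ˣ)) (hev : ∀ (t : Lbl) (g : P₀) (a : Afun), ev t (s t g • a) = g • ev t a)
    (hcev : ∀ (t : Lbl) (ζ : cyclotome Afun), c₀.hom (cyclotome.map (ev t) ζ) = cf.hom ζ)
    {θ : ((thetaEnvData C hC hS hl hp2 hpl hζ mods f hf hmods h15 L hZ hcharY hlim).toRecord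
        (h1LimConjMulAut (phi C) (D.lDeltaTheta l) (PiYdd C))
        (h1LimKummerOn (phi C) (D.lDeltaTheta l) (PiYdd C) c hA hfi O) iota).H}
    {fΘ : Afun}
    (hθf : AddEquiv.additiveMultiplicative (h1Lim (phi C) (D.lDeltaTheta l) (PiYdd C) ⊥) (Additive.ofMul θ) =
      Multiplicative.toAdd (h1LimKummer (phi C) (D.lDeltaTheta l) (PiYdd C) cf hAf hfif fΘ))
    (q : Lbl → O) (hval : ∀ t, ev t fΘ = (q t : (PadicAlgCl p)ˣ)) (t : Lbl) :
    R t θ = h1LimKummerOn φ₀ (D.lDeltaTheta l) ⊤ c₀ hA₀ hfi₀ O (q t) := by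
  rw [h1LimKummerOn_apply, ← hval t]
  exact restriction_kummer_eq_kummer_eval
    ((thetaEnvData C hC hS hl hp2 hpl hζ mods f hf hmods h15 L hZ hcharY hlim).toRecord
      (h1LimConjMulAut (phi C) (D.lDeltaTheta l) (PiYdd C))
      (h1LimKummerOn (phi C) (D.lDeltaTheta l) (PiYdd C) c hA hfi O) iota)
    (phi C) φ₀ (D.lDeltaTheta l) (PiYdd C) cf hAf hfif c₀ hA₀ hfi₀ (MonoidHom.id (Pi C))
    (AddEquiv.additiveMultiplicative (h1Lim (phi C) (D.lDeltaTheta l) (PiYdd C) ⊥)) (s t) (hι t) (hN t) (hφ t)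
    (ev t) (fun g a => hev t g a) (hcev t) (R t) (hR t) hθf

/-- **IUTchII:Cor3.5(ii)** (kurims p.95) "`Ψ^ι_env(M^Θ_*) ⥲ Ψ_ξ(M^Θ_*)`" **at the genuine `θ_env` data over `ℚ̄_pˣ` from
PRINT-SHAPED INPUTS** (any inversion family `iota`): the UNIQUE restriction isomorphism `Ψ^{i₀}_env(𝕄_*) ⥲ Ψ_ξ ⊆ ∏_t κ₀(O)`,
`ξ = (κ₀ q_t)_t`, with EVERY junction hypothesis of [IUTchII] §3 — (K), (R), (E), `hU`, `hUsurj`, `hinj`, `hq₀` — DERIVED.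
Inputs: the evaluation sections `s_t` (continuous into `Π^tp_{Ÿ̲̲}`, common `φ₀`, `G_v` acting on `ℚ̄_pˣ` as through them, one
with finite-index `ε`-image); the model data (`c`, `c₀` bijective with the same underlying map; `O ≤ ℚ̄_pˣ`); a module of
functions `Afun` with Kummer data `cf` and evaluations `ev_t` equivariant along `s_t` with `c₀ ∘ Λ(ev_t) = cf`; the
presentation `θ = κ_fun(fΘ)` of the theta class and its VALUES `ev_t fΘ = q_t ∈ O`, `q_{t₀}` a non-unit ([EtTh] Prop 1.3,
Prop 1.4 (iii), [IUTchII] Rmk 2.5.1 (i)); `θ ∈ θ^{i₀}_env(𝕄_*)` and `horb`. [cite: Mochizuki2012, Cor 3.5 (ii) p.95] -/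
theorem exists_unique_restrictionIso'_toRecord_padic_of_evaluation (hc : Function.Bijective c.hom)
    (hc₀ : Function.Bijective c₀.hom) (hc₀c : ∀ ζ, c₀.hom ζ = c.hom ζ)
    (hact : ∀ (t : Lbl) (g : P₀) (a : (PadicAlgCl p)ˣ), g • a = s t g • a) (t₁ : Lbl)
    [((EtaleThetaDataOfSetting.aug C).comp (s t₁)).range.FiniteIndex]
    {i₀ : Iota}
    {θ : ((thetaEnvData C hC hS hl hp2 hpl hζ mods f hf hmods h15 L hZ hcharY hlim).toRecord
        (h1LimConjMulAut (phi C) (D.lDeltaTheta l) (PiYdd C))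
        (h1LimKummerOn (phi C) (D.lDeltaTheta l) (PiYdd C) c hA hfi O) iota).H}
    (hθ : θ ∈ ((thetaEnvData C hC hS hl hp2 hpl hζ mods f hf hmods h15 L hZ hcharY hlim).toRecord
        (h1LimConjMulAut (phi C) (D.lDeltaTheta l) (PiYdd C))
        (h1LimKummerOn (phi C) (D.lDeltaTheta l) (PiYdd C) c hA hfi O) iota).thetaEnv i₀)
    (horb : ∀ θ' ∈ ((thetaEnvData C hC hS hl hp2 hpl hζ mods f hf hmods h15 L hZ hcharY hlim).toRecord
        (h1LimConjMulAut (phi C) (D.lDeltaTheta l) (PiYdd C))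
        (h1LimKummerOn (phi C) (D.lDeltaTheta l) (PiYdd C) c hA hfi O) iota).thetaEnv i₀,
      ∃ u ∈ ((thetaEnvData C hC hS hl hp2 hpl hζ mods f hf hmods h15 L hZ hcharY hlim).toRecord
        (h1LimConjMulAut (phi C) (D.lDeltaTheta l) (PiYdd C))
        (h1LimKummerOn (phi C) (D.lDeltaTheta l) (PiYdd C) c hA hfi O) iota).units, θ' = u * θ)
    (R : Lbl → (((thetaEnvData C hC hS hl hp2 hpl hζ mods f hf hmods h15 L hZ hcharY hlim).toRecord
        (h1LimConjMulAut (phi C) (D.lDeltaTheta l) (PiYdd C))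
        (h1LimKummerOn (phi C) (D.lDeltaTheta l) (PiYdd C) c hA hfi O) iota).H →*
      Multiplicative (h1Lim φ₀ (D.lDeltaTheta l) (⊤ : Subgroup P₀) ⊥)))
    (hR : ∀ t y, Multiplicative.toAdd (R t y) =
      h1LimCongr (D.lDeltaTheta l) ⊤ (hφ t) ⊥
        (h1LimComap (phi C) (D.lDeltaTheta l) ((MonoidHom.id (Pi C)).comp (s t)) (hι t) (hN t)
          (AddEquiv.additiveMultiplicative (h1Lim (phi C) (D.lDeltaTheta l) (PiYdd C) ⊥) (Additive.ofMul y))))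
    (ev : Lbl → (Afun →* (PadicAlgCl p)ˣ)) (hev : ∀ (t : Lbl) (g : P₀) (a : Afun), ev t (s t g • a) = g • ev t a)
    (hcev : ∀ (t : Lbl) (ζ : cyclotome Afun), c₀.hom (cyclotome.map (ev t) ζ) = cf.hom ζ)
    {fΘ : Afun}
    (hθf : AddEquiv.additiveMultiplicative (h1Lim (phi C) (D.lDeltaTheta l) (PiYdd C) ⊥) (Additive.ofMul θ) =
      Multiplicative.toAdd (h1LimKummer (phi C) (D.lDeltaTheta l) (PiYdd C) cf hAf hfif fΘ))
    (q : Lbl → O) (hval : ∀ t, ev t fΘ = (q t : (PadicAlgCl p)ˣ)) (t₀ : Lbl) (hq : ¬ IsUnit (q t₀)) :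
    ∃! e : ((thetaEnvData C hC hS hl hp2 hpl hζ mods f hf hmods h15 L hZ hcharY hlim).toRecord
          (h1LimConjMulAut (phi C) (D.lDeltaTheta l) (PiYdd C))
          (h1LimKummerOn (phi C) (D.lDeltaTheta l) (PiYdd C) c hA hfi O) iota).thetaMonoid i₀ ≃*
        gaussianMonoid (fun t =>
          ((R t).comp (((thetaEnvData C hC hS hl hp2 hpl hζ mods f hf hmods h15 L hZ hcharY hlim).toRecord
              (h1LimConjMulAut (phi C) (D.lDeltaTheta l) (PiYdd C))
              (h1LimKummerOn (phi C) (D.lDeltaTheta l) (PiYdd C) c hA hfi O) iota).thetaMonoid i₀).subtype).codRestrict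
            (MonoidHom.mrange (h1LimKummerOn φ₀ (D.lDeltaTheta l) ⊤ c₀ hA₀ hfi₀ O))
            (restriction_mem_mrange_gen
              ((thetaEnvData C hC hS hl hp2 hpl hζ mods f hf hmods h15 L hZ hcharY hlim).toRecord
                (h1LimConjMulAut (phi C) (D.lDeltaTheta l) (PiYdd C))
                (h1LimKummerOn (phi C) (D.lDeltaTheta l) (PiYdd C) c hA hfi O) iota)
              (h1LimKummerOn (phi C) (D.lDeltaTheta l) (PiYdd C) c hA hfi O)
              (h1LimKummerOn φ₀ (D.lDeltaTheta l) ⊤ c₀ hA₀ hfi₀ O)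
              (fun t => (R t).comp (((thetaEnvData C hC hS hl hp2 hpl hζ mods f hf hmods h15 L hZ hcharY hlim).toRecord
                (h1LimConjMulAut (phi C) (D.lDeltaTheta l) (PiYdd C))
                (h1LimKummerOn (phi C) (D.lDeltaTheta l) (PiYdd C) c hA hfi O) iota).thetaMonoid i₀).subtype)
              q (hκ_padic C c hA hfi O hc) (ThetaEnvData.toRecord_constantMonoid _ _ _ _) hθ horb
              (fun t m hm => hRκ_toRecord C hC hS hl hp2 hpl hζ mods f hf hmods h15 L hZ hcharY hlim iota φ₀ s hι hN hφ c
                hA hfi O c₀ hA₀ hfi₀ hc₀c hact R hR t m hm)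
              (fun t => hRθ_toRecord_of_evaluation C hC hS hl hp2 hpl hζ mods f hf hmods h15 L hZ hcharY hlim iota φ₀ s hι hN
                hφ c hA hfi O c₀ hA₀ hfi₀ cf hAf hfif R hR ev hev hcev hθf q hval t) t)
            ⟨θ, thetaEnv_subset_thetaMonoid
              ((thetaEnvData C hC hS hl hp2 hpl hζ mods f hf hmods h15 L hZ hcharY hlim).toRecord
                (h1LimConjMulAut (phi C) (D.lDeltaTheta l) (PiYdd C))
                (h1LimKummerOn (phi C) (D.lDeltaTheta l) (PiYdd C) c hA hfi O) iota) i₀ hθ⟩),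
      ∀ x, ((e x : gaussianMonoid _) : Lbl → MonoidHom.mrange (h1LimKummerOn φ₀ (D.lDeltaTheta l) ⊤ c₀ hA₀ hfi₀ O)) =
        MonoidHom.pi (fun t =>
          ((R t).comp (((thetaEnvData C hC hS hl hp2 hpl hζ mods f hf hmods h15 L hZ hcharY hlim).toRecord
              (h1LimConjMulAut (phi C) (D.lDeltaTheta l) (PiYdd C))
              (h1LimKummerOn (phi C) (D.lDeltaTheta l) (PiYdd C) c hA hfi O) iota).thetaMonoid i₀).subtype).codRestrict
            (MonoidHom.mrange (h1LimKummerOn φ₀ (D.lDeltaTheta l) ⊤ c₀ hA₀ hfi₀ O))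
            (restriction_mem_mrange_gen
              ((thetaEnvData C hC hS hl hp2 hpl hζ mods f hf hmods h15 L hZ hcharY hlim).toRecord
                (h1LimConjMulAut (phi C) (D.lDeltaTheta l) (PiYdd C))
                (h1LimKummerOn (phi C) (D.lDeltaTheta l) (PiYdd C) c hA hfi O) iota)
              (h1LimKummerOn (phi C) (D.lDeltaTheta l) (PiYdd C) c hA hfi O)
              (h1LimKummerOn φ₀ (D.lDeltaTheta l) ⊤ c₀ hA₀ hfi₀ O)
              (fun t => (R t).comp (((thetaEnvData C hC hS hl hp2 hpl hζ mods f hf hmods h15 L hZ hcharY hlim).toRecord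
                (h1LimConjMulAut (phi C) (D.lDeltaTheta l) (PiYdd C))
                (h1LimKummerOn (phi C) (D.lDeltaTheta l) (PiYdd C) c hA hfi O) iota).thetaMonoid i₀).subtype)
              q (hκ_padic C c hA hfi O hc) (ThetaEnvData.toRecord_constantMonoid _ _ _ _) hθ horb
              (fun t m hm => hRκ_toRecord C hC hS hl hp2 hpl hζ mods f hf hmods h15 L hZ hcharY hlim iota φ₀ s hι hN hφ c
                hA hfi O c₀ hA₀ hfi₀ hc₀c hact R hR t m hm)
              (fun t => hRθ_toRecord_of_evaluation C hC hS hl hp2 hpl hζ mods f hf hmods h15 L hZ hcharY hlim iota φ₀ s hι hN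
                hφ c hA hfi O c₀ hA₀ hfi₀ cf hAf hfif R hR ev hev hcev hθf q hval t) t)) x :=
  exists_unique_restrictionIso'_toRecord_padic C hC hS hl hp2 hpl hζ mods f hf hmods h15 L hZ hcharY hlim iota φ₀ s hι hN hφ c
    hA hfi O c₀ hA₀ hfi₀ hc hc₀ hc₀c hact t₁ hθ horb R hR q
    (fun t => hRθ_toRecord_of_evaluation C hC hS hl hp2 hpl hζ mods f hf hmods h15 L hZ hcharY hlim iota φ₀ s hι hN hφ c hA
      hfi O c₀ hA₀ hfi₀ cf hAf hfif R hR ev hev hcev hθf q hval t) t₀ hq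

end EtaleLevels

end Literature.IUT.HodgeArakelov

end
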